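import Summits.NavierStokesRegularity.FluidComputer.ClayBlowupSingularSliceHausdorffOne
import Literature.Analysis.FluidPDE.TsaiTopSingularNullForced
import HarnessLib

/-!
# THE SINGULAR SLICE OF EVERY CLAY BLOW-UP IS `ℋ¹`-NULL (forced case: Fefferman's (C) type)

Cell `ns-blowup`, seat `ns-blowup-ecbridge-2` (g7; the E–C endpoint theory seat). LABEL: E–C typing
(KERNEL — no named fact). WHAT THIS IS NOT: not Navier–Stokes evidence — a necessary condition on the
TYPES `ClayBlowup ν` / `DesignedBlowup ν` (no inhabitant is claimed anywhere; by g6's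
`navierStokesBreakdownR3_iff_exists_nonempty_designedBlowup` an inhabitant is exactly a witness of
Fefferman's (C)). Companion memo: `run/shared/lean/pub/ns-blowup/ecbridge2/ECBRIDGE-2-MEMO-6.md`.

## Content (Caffarelli–Kohn–Nirenberg's Theorem B at the first blow-up time, WITH the Clay force)

`ClayBlowupSingularSliceHausdorffOne.lean` settled the unforced case through the tree's unforced
top-slice theorem `tsai1998_top_singular_null_holds`. The forced case uses the new Literature theorem
`tsai1998_top_singular_null_forced` (`TsaiTopSingularNullForced`: Tsai's Lemma 4.2 / CKN's
Proposition 2 and the Theorem-B covering AT THE TOP of a cylinder, for data in Lemarié-Rieusset's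
§14.3 class with a general `L³` force — the gradient part of the force is absorbed into the pressure
on unit cylinders), whose hypotheses on the backward cylinders `Q_{√(T/2)}(T, c)` are EXACTLY g6's
`ClayBlowup.exists_isLRSuitableWeakSolutionOn_cylinder_top` (the through-`T` classes: one energy
bound, integrable dissipation, `p_N = p̃[u] + Δ⁻¹∇·f ∈ L^{3/2}`, the bounded Clay force, the forced
suitable weak formulation of `(u, p_N)` on the open lifespan slab):

* `ClayBlowup.hausdorffMeasure_one_singularSlice_inter_ball_eq_zero` — ball-local nullity;
* **`ClayBlowup.hausdorffMeasure_one_singularSlice_eq_zero (hν : 0 < ν) : μH[1] S_T = 0`**,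
  `S_T = {x₀ | ¬ IsBackwardBoundedAt u T x₀}` — one full dimension below g6's
  `hausdorffMeasure_two_singularSlice_eq_zero`, and the known optimum (CKN 1982, Theorem B:
  `𝒫¹(S) = 0`; Lemarié-Rieusset 2016, Thm. 13.9 and p. 771);
* `ClayBlowup.singularSlice_compact_nonempty_hausdorffOne_null` — the singular slice of every Clay
  blow-up is a NONEMPTY COMPACT `ℋ¹`-NULL set; the `DesignedBlowup` twins;
* `navierStokesBreakdownR3_iff_exists_designedBlowup_hausdorffOne_null` — (C) holds iff some
  designed blow-up exists, and then (as always) its singular slice is nonempty, compact, `ℋ¹`-null: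
  a breakdown scenario for (C) whose singular set at the blow-up time contains a curve of positive
  length (filament or vortex-ring collapse onto a circle), a sheet or a volume is NOT a Clay blow-up.

References: L. Caffarelli, R. Kohn, L. Nirenberg, CPAM 35 (1982), Thm. B, Prop. 2, §1, §6
[cite: CaffarelliKohnNirenberg1982, Theorem B]; T.-P. Tsai, ARMA 143 (1998), Lemma 4.2 and remark
(p. 46) [cite: Tsai1998, Lemma 4.2 (p. 46)]; P. G. Lemarié-Rieusset (2016), Thm. 13.9 (p. 479), Thm.
14.4 (p. 505), p. 771 [cite: LemarieRieusset2016, Thm. 13.9]; C. L. Fefferman, Clay problem description,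
(C) [cite: FeffermanClay2006, (C)].
-/

noncomputable section

namespace Summit.NavierStokesRegularity.FluidComputer

open Set MeasureTheory Filter Topology Function TopologicalSpace Metric
open scoped ENNReal NNReal
open Literature.Analysis.FluidPDE
open Summit.NavierStokesRegularity.NavierStokesRegularity
open Summit.NavierStokesRegularity.FluidComputer.PalasekTowerClayBridge

namespace ClayBlowup

variable {ν : ℝ} (X : ClayBlowup ν)

/-- **`ℋ¹`-NULLITY OF THE SINGULAR SLICE INSIDE ONE BALL**, for EVERY Clay blow-up at `ν > 0`
(forced): for every centre `c`, `μH[1] ({x₀ | ¬ IsBackwardBoundedAt u T x₀} ∩ B(c, √(T/2))) = 0`.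
The forced top-slice theorem `tsai1998_top_singular_null_forced` on the backward cylinder
`Q_{√(T/2)}(T, c)`, fed with `exists_isLRSuitableWeakSolutionOn_cylinder_top` (g6); singular-slice
points are backward singular points (`singularSlice_inter_ball_subset`). No named fact.
[cite: CaffarelliKohnNirenberg1982, Theorem B (§6, p. 807) and Proposition 2] [cite: Tsai1998, Lemma 4.2 and the following remark (p. 46)] -/
theorem hausdorffMeasure_one_singularSlice_inter_ball_eq_zero (hν : 0 < ν)
    (c : EuclideanSpace ℝ (Fin 3)) :
    μH[1] ({x₀ : EuclideanSpace ℝ (Fin 3) | ¬ IsBackwardBoundedAt X.u X.T x₀} ∩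
      ball c (Real.sqrt (X.T / 2))) = 0 := by
  have hT := X.T_pos
  have hρ0 : 0 < Real.sqrt (X.T / 2) := Real.sqrt_pos.2 (by positivity)
  have hρT : Real.sqrt (X.T / 2) ^ 2 ≤ X.T := by
    rw [Real.sq_sqrt (by positivity)]
    linarith
  obtain ⟨G, hLR⟩ := X.exists_isLRSuitableWeakSolutionOn_cylinder_top hν c hρ0 hρT
  exact measure_mono_null (X.singularSlice_inter_ball_subset c _)
    (tsai1998_top_singular_null_forced hν hρ0 hLR)

/-- **THE SINGULAR SLICE OF EVERY CLAY BLOW-UP HAS ONE-DIMENSIONAL HAUSDORFF MEASURE ZERO**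
(`ν > 0`; the force is the Clay force of the type, no restriction): `μH[1] {x₀ | ¬ IsBackwardBoundedAt u T x₀} = 0`.
Caffarelli–Kohn–Nirenberg's Theorem B at the first blow-up time: a finite cover of the compact
singular slice (`isCompact_singularSlice`) by balls of radius `√(T/2)`, on each of which the forced
top-slice theorem applies. This sharpens g6's `hausdorffMeasure_two_singularSlice_eq_zero` by one
dimension, to the known optimum. No named fact.
[cite: CaffarelliKohnNirenberg1982, Theorem B (§6, p. 807)] [cite: LemarieRieusset2016, Thm. 13.9 (p. 479) and p. 771] -/
theorem hausdorffMeasure_one_singularSlice_eq_zero (hν : 0 < ν) :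
    μH[1] {x₀ : EuclideanSpace ℝ (Fin 3) | ¬ IsBackwardBoundedAt X.u X.T x₀} = 0 := by
  have hT := X.T_pos
  set S : Set (EuclideanSpace ℝ (Fin 3)) :=
    {x₀ : EuclideanSpace ℝ (Fin 3) | ¬ IsBackwardBoundedAt X.u X.T x₀} with hS
  have hρ0 : 0 < Real.sqrt (X.T / 2) := Real.sqrt_pos.2 (by positivity)
  obtain ⟨t, -, htfin, hcover⟩ := finite_cover_balls_of_compact (X.isCompact_singularSlice hν).1 hρ0
  have hSU : S ⊆ ⋃ c ∈ t, S ∩ ball c (Real.sqrt (X.T / 2)) := by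
    intro x hx
    obtain ⟨c, hc, hxc⟩ := mem_iUnion₂.1 (hcover hx)
    exact mem_iUnion₂.2 ⟨c, hc, hx, hxc⟩
  refine measure_mono_null hSU ((measure_biUnion_null_iff htfin.countable).2 fun c _ => ?_)
  exact X.hausdorffMeasure_one_singularSlice_inter_ball_eq_zero hν c

/-- **Summary row for every Clay blow-up** (`ν > 0`): the singular slice is a NONEMPTY COMPACT
`ℋ¹`-NULL set. No named fact. [cite: CaffarelliKohnNirenberg1982, Theorem B (§6, p. 807)] -/
theorem singularSlice_compact_nonempty_hausdorffOne_null (hν : 0 < ν) :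
    IsCompact {x₀ : EuclideanSpace ℝ (Fin 3) | ¬ IsBackwardBoundedAt X.u X.T x₀} ∧
      {x₀ : EuclideanSpace ℝ (Fin 3) | ¬ IsBackwardBoundedAt X.u X.T x₀}.Nonempty ∧
        μH[1] {x₀ : EuclideanSpace ℝ (Fin 3) | ¬ IsBackwardBoundedAt X.u X.T x₀} = 0 :=
  ⟨(X.isCompact_singularSlice hν).1, (X.isCompact_singularSlice hν).2,
    X.hausdorffMeasure_one_singularSlice_eq_zero hν⟩

end ClayBlowup

namespace DesignedBlowup

variable {ν : ℝ} (D : DesignedBlowup ν)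

/-- **The singular slice of every designed blow-up has one-dimensional Hausdorff measure zero**
(`ν > 0`; `toClayBlowup`). [cite: CaffarelliKohnNirenberg1982, Theorem B (§6, p. 807)] -/
theorem hausdorffMeasure_one_singularSlice_eq_zero (hν : 0 < ν) :
    μH[1] {x₀ : EuclideanSpace ℝ (Fin 3) | ¬ IsBackwardBoundedAt D.u D.T x₀} = 0 :=
  D.toClayBlowup.hausdorffMeasure_one_singularSlice_eq_zero hν

/-- **The singular slice of every designed blow-up is a nonempty compact `ℋ¹`-null set** (`ν > 0`).
[cite: CaffarelliKohnNirenberg1982, Theorem B (§6, p. 807)] -/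
theorem singularSlice_compact_nonempty_hausdorffOne_null (hν : 0 < ν) :
    IsCompact {x₀ : EuclideanSpace ℝ (Fin 3) | ¬ IsBackwardBoundedAt D.u D.T x₀} ∧
      {x₀ : EuclideanSpace ℝ (Fin 3) | ¬ IsBackwardBoundedAt D.u D.T x₀}.Nonempty ∧
        μH[1] {x₀ : EuclideanSpace ℝ (Fin 3) | ¬ IsBackwardBoundedAt D.u D.T x₀} = 0 :=
  D.toClayBlowup.singularSlice_compact_nonempty_hausdorffOne_null hν

end DesignedBlowup

/-! ## The (C)-side reading -/

/-- **(C) ⟺ SOME DESIGNED BLOW-UP EXISTS — AND THEN ITS SINGULAR SLICE IS A NONEMPTY COMPACT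
`ℋ¹`-NULL SET**: `NavierStokesBreakdownR3` holds iff at some `ν > 0` there is a designed blow-up
whose singular slice is nonempty, compact and `ℋ¹`-null (the extra clause costs nothing: every
designed blow-up has it). g6's `navierStokesBreakdownR3_iff_exists_nonempty_designedBlowup` plus the
theorem above. Neither side is asserted. [cite: FeffermanClay2006, (C)]
[cite: CaffarelliKohnNirenberg1982, Theorem B (§6, p. 807)] -/
theorem navierStokesBreakdownR3_iff_exists_designedBlowup_hausdorffOne_null :
    NavierStokesRegularity.NavierStokesBreakdownR3 ↔
      ∃ ν : ℝ, 0 < ν ∧ ∃ D : DesignedBlowup ν,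
        IsCompact {x₀ : EuclideanSpace ℝ (Fin 3) | ¬ IsBackwardBoundedAt D.u D.T x₀} ∧
          {x₀ : EuclideanSpace ℝ (Fin 3) | ¬ IsBackwardBoundedAt D.u D.T x₀}.Nonempty ∧
            μH[1] {x₀ : EuclideanSpace ℝ (Fin 3) | ¬ IsBackwardBoundedAt D.u D.T x₀} = 0 := by
  rw [navierStokesBreakdownR3_iff_exists_nonempty_designedBlowup]
  constructor
  · rintro ⟨ν, hν, ⟨D⟩⟩
    exact ⟨ν, hν, D, D.singularSlice_compact_nonempty_hausdorffOne_null hν⟩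
  · rintro ⟨ν, hν, D, -⟩
    exact ⟨ν, hν, ⟨D⟩⟩

end Summit.NavierStokesRegularity.FluidComputer

end
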